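import Literature.NumberTheory.Transcendental.BakerRealLogarithms
import Summits.KontsevichZagierPeriods.KontsevichZagierPeriods.Theorems.InverseLandauTateLiftingBakerDecomposition

/-!
# `StokesGeneration` (stmt-KontsevichZagierPeriods-3586) — line `fibrewise_stokes`, stub `stub_rungInhomBaker`

Registered rung stub R4 of the line `fibrewise_stokes` of the crux `StokesGeneration` (route
UnfoldedStokes): **Baker's theorem, inhomogeneous coefficient form, WITHOUT a linear-independence
hypothesis on the logarithms.** If `ε₁, …, ε_s > 0` are real algebraic, `r, C₁, …, C_s` are real
algebraic and `r + Σᵢ Cᵢ log εᵢ = 0`, then `r = 0`.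

Proof. Choose a maximal `ℚ`-linearly independent subfamily `(log ε_j)_{j ∈ J}` of the logarithms
(`Summit.KontsevichZagierPeriods.InverseLandau.tateLifting_exists_finset_linearIndependent`, i.e.
`exists_linearIndepOn_extension`): every `log εᵢ` is a rational combination
`log εᵢ = Σ_{j ∈ J} q_ij log ε_j`. Regrouping,
`r + Σᵢ Cᵢ log εᵢ = r + Σ_{j ∈ J} (Σᵢ Cᵢ q_ij) log ε_j`, whose coefficients `Σᵢ Cᵢ q_ij` are real
algebraic (the real algebraic numbers form the field `algebraicClosure ℚ ℝ`). The real coefficient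
form of Baker's theorem — PROVED in the tree as
`Literature.NumberTheory.Transcendental.baker_real_coeff` (a corollary of `baker_holds`), applied
to the `ℚ`-linearly independent family `(log ε_j)_{j ∈ J}` with `exp (log ε_j) = ε_j` algebraic —
forces the constant coefficient `r` to vanish.

Reference: A. Baker, *Transcendental Number Theory*, Cambridge Univ. Press (1975), Ch. 2,
Theorem 2.1.
-/

noncomputable section

-- `Summit.KontsevichZagierPeriods.KontsevichZagierPeriods.…` is the tree's mandated layout (single-conjunct summit).
set_option linter.dupNamespace false

namespace Summit.KontsevichZagierPeriods.KontsevichZagierPeriods.Cruxes.StokesGeneration.FibrewiseStokes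

open Literature.NumberTheory.Transcendental
open Summit.KontsevichZagierPeriods.InverseLandau (tateLifting_exists_finset_linearIndependent)

/-- **Regrouping along a spanning subfamily.** If every `L i` is a rational combination
`L i = Σ_{j} q i j • L j` of a subfamily indexed by `j ∈ J`, then an algebraic-coefficient
combination `Σᵢ Cᵢ L i` is the combination `Σ_{j ∈ J} (Σᵢ Cᵢ q_ij) L j` of the subfamily, and its
coefficients `Σᵢ Cᵢ q_ij` are again real algebraic. [cite: Baker1975, Thm 2.1] -/
theorem rungInhomBaker_regroup {s : ℕ} {L C : Fin s → ℝ} (J : Finset (Fin s))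
    (q : Fin s → J → ℚ) (hq : ∀ i, ∑ j, q i j • L j = L i) (hC : ∀ i, IsAlgebraic ℚ (C i)) :
    ∑ i, C i * L i = ∑ j : J, (∑ i, C i * (q i j : ℝ)) * L j ∧
      ∀ j : J, IsAlgebraic ℚ (∑ i, C i * (q i j : ℝ)) := by
  refine ⟨?_, fun j => ?_⟩
  · calc ∑ i, C i * L i = ∑ i, C i * ∑ j : J, (q i j : ℝ) * L j := by
          refine Finset.sum_congr rfl fun i _ => ?_
          rw [← hq i]
          simp only [Rat.smul_def]
      _ = ∑ j : J, (∑ i, C i * (q i j : ℝ)) * L j := by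
          simp only [Finset.mul_sum, Finset.sum_mul, mul_assoc]
          exact Finset.sum_comm
  · exact mem_algebraicClosure_iff.mp (sum_mem fun i _ =>
      mul_mem (mem_algebraicClosure_iff.mpr (hC i)) (SubfieldClass.ratCast_mem _ _))

/-- **Registered stub `stub_rungInhomBaker` (rung R4): Baker's theorem, inhomogeneous coefficient
form, without an independence hypothesis.** If `εᵢ > 0` are real algebraic, `r, Cᵢ` are real
algebraic and `r + Σᵢ Cᵢ log εᵢ = 0`, then `r = 0`: reduce to a maximal `ℚ`-linearly independent
subfamily of the `log εᵢ` (`tateLifting_exists_finset_linearIndependent`, rational coordinates by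
`Submodule.mem_span_image_finset_iff_exists_fun`, regrouping `rungInhomBaker_regroup`), then apply
the proved real coefficient form `baker_real_coeff` of Baker's Theorem 2.1.
[cite: Baker1975, Thm 2.1] -/
theorem stub_rungInhomBaker :
    ∀ (s : ℕ) (ε C : Fin s → ℝ) (r : ℝ), (∀ i, 0 < ε i) → (∀ i, IsAlgebraic ℚ (ε i)) →
      (∀ i, IsAlgebraic ℚ (C i)) → IsAlgebraic ℚ r → r + ∑ i, C i * Real.log (ε i) = 0 → r = 0 := by
  intro s ε C r hε hεa hCa hra h
  classical
  -- (1) a maximal `ℚ`-linearly independent subfamily `(log ε_j)_{j ∈ J}`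
  obtain ⟨J, hJli, hJsp⟩ : ∃ J : Finset (Fin s),
      LinearIndependent ℚ (fun j : J => Real.log (ε j)) ∧
        ∀ i, Real.log (ε i) ∈ Submodule.span ℚ ((fun k => Real.log (ε k)) '' ↑J) :=
    tateLifting_exists_finset_linearIndependent ℚ fun k => Real.log (ε k)
  -- (2) rational coordinates of every `log εᵢ` on the subfamily
  have hcoef : ∀ i, ∃ c : J → ℚ, ∑ j, c j • Real.log (ε j) = Real.log (ε i) :=
    fun i => (Submodule.mem_span_image_finset_iff_exists_fun ℚ).mp (hJsp i)
  choose q hq using hcoef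
  -- (3) regroup the relation along the subfamily; the new coefficients are algebraic
  obtain ⟨hsum, hβ⟩ := rungInhomBaker_regroup (L := fun k => Real.log (ε k)) J q hq hCa
  have hrel : r + ∑ j : J, (∑ i, C i * (q i j : ℝ)) * Real.log (ε j) = 0 := by
    rw [← hsum]
    exact h
  -- (4) Baker's theorem (real coefficient form) on the independent subfamily
  have halg : ∀ j : J, IsAlgebraic ℚ (Real.exp (Real.log (ε j))) := fun j => by
    rw [Real.exp_log (hε j)]
    exact hεa j
  exact (baker_real_coeff (fun j : J => Real.log (ε j)) halg hJli hra hβ hrel).1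

end Summit.KontsevichZagierPeriods.KontsevichZagierPeriods.Cruxes.StokesGeneration.FibrewiseStokes

end
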